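import Mathlib

/-!
# CLASS C5 of the single-`d` statement — the assembly (blind cell PercRepro2, p3 g28,
2026-08-28; `proofs/P3-PENDANT.md` §5)

The abstract shape of the class «the root blocks see the pocket only through a mark».  A
state is a pair `(x, z)`: the sides `x ⊆ ι` of the blocks joined to `d` or linking `r, s`
(with `S ⊆ ι` the blocks joined to `d`) and the rest `z ⊆ γ` (the pocket edges and the sides
of the other blocks, in the `𝔴`-order).  `σ_rs = f x` is monotone and odd, `σ_pq = g z` is
antitone and odd, and legality is «`z ∈ U` when `d` is `Y`-reached, `zᶜ ∈ U` when `d` is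
`W`-reached, both and `z ∈ D` when `d` is doubly reached» for an up-set `U` (the `Y`-pocket
avoids the marks and the `W`-hubs) and a complement-closed `D` (the two pockets meet in `d`
only).  The legal sum of `σ_pq σ_rs` is non-positive (`c5_sum_nonpos`): it equals
`2 · (∑_{z ∈ U} g z) · (∑_{S ⊆ x} f x)`, the first factor `≤ 0` by Harris (an up-set against
an antitone odd function, `sum_upset_nonpos`), the second `≥ 0` by the involution
`x ↦ S ∪ xᶜ`.  No definitions.  Own work; std axioms.
-/

namespace Summit.Ventures.PercRepro2

namespace M9Reduce

open Finset

/-- **The up-set lemma.** For an up-set `U` of a finite Boolean lattice and an antitone `g`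
with `g zᶜ = -g z`: `∑_{z ∈ U} g z ≤ 0`. -/
theorem sum_upset_nonpos {γ : Type*} [Fintype γ] [DecidableEq γ] {U : Finset (Finset γ)}
    (hU : ∀ ⦃z z' : Finset γ⦄, z ∈ U → z ⊆ z' → z' ∈ U) {g : Finset γ → ℤ} (hg : Antitone g)
    (hgκ : ∀ z, g zᶜ = -g z) : ∑ z ∈ U, g z ≤ 0 := by
  classical
  -- `∑ g = 0` by the complement
  have hzero : ∑ z : Finset γ, g z = 0 := by
    have h1 : ∑ z : Finset γ, g zᶜ = ∑ z : Finset γ, g z :=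
      Finset.sum_nbij' compl compl (fun z _ => Finset.mem_univ _) (fun z _ => Finset.mem_univ _)
        (fun z _ => compl_compl z) (fun z _ => compl_compl z) (fun z _ => rfl)
    have h2 : ∑ z : Finset γ, g zᶜ = -∑ z : Finset γ, g z := by
      rw [← Finset.sum_neg_distrib]; exact Finset.sum_congr rfl fun z _ => hgκ z
    linarith
  -- FKG for the indicator of `U` and the shifted `-g`
  let k : ℤ := ∑ z, |g z|
  have habs : ∀ z, |g z| ≤ k := fun z =>
    Finset.single_le_sum (f := fun z => |g z|) (fun z _ => abs_nonneg _) (Finset.mem_univ z)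
  let F : Finset γ → ℤ := fun z => if z ∈ U then 1 else 0
  let K : Finset γ → ℤ := fun z => k - g z
  let μ : Finset γ → ℤ := fun _ => 1
  have hμ₀ : 0 ≤ μ := fun _ => by simp [μ]
  have hF₀ : 0 ≤ F := fun z => by simp only [F, Pi.zero_apply]; split_ifs <;> norm_num
  have hK₀ : 0 ≤ K := fun z => by
    have := abs_le.1 (habs z); simp only [K, Pi.zero_apply]; linarith
  have hFmono : Monotone F := by
    intro z z' hzz'
    simp only [F]
    by_cases hz : z ∈ U
    · rw [if_pos hz, if_pos (hU hz hzz')]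
    · rw [if_neg hz]; split_ifs <;> norm_num
  have hKmono : Monotone K := fun z z' hzz' => by
    simp only [K]; have := hg hzz'; linarith
  have hμ : ∀ a b, μ a * μ b ≤ μ (a ⊓ b) * μ (a ⊔ b) := fun a b => by simp [μ]
  have key := fkg F K μ hμ₀ hF₀ hK₀ hFmono hKmono hμ
  simp only [μ, one_mul] at key
  -- expand
  have eF : ∑ z : Finset γ, F z = (U.card : ℤ) := by
    simp only [F]; rw [Finset.sum_boole]; simp
  have eK : ∑ z : Finset γ, K z = k * Fintype.card (Finset γ) := by
    simp only [K]
    rw [Finset.sum_sub_distrib, hzero, sub_zero, Finset.sum_const, Finset.card_univ,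
      nsmul_eq_mul]; ring
  have eFK : ∑ z : Finset γ, F z * K z = k * U.card - ∑ z ∈ U, g z := by
    simp only [F, K]
    have : ∀ z : Finset γ, (if z ∈ U then (1 : ℤ) else 0) * (k - g z) =
        k * (if z ∈ U then (1 : ℤ) else 0) - (if z ∈ U then g z else 0) := fun z => by
      split_ifs <;> ring
    simp_rw [this]
    rw [Finset.sum_sub_distrib, ← Finset.mul_sum, Finset.sum_boole, Finset.sum_ite_mem,
      Finset.univ_inter]
    simp
  have eμ : ∑ _z : Finset γ, (1 : ℤ) = Fintype.card (Finset γ) := by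
    rw [Finset.sum_const, Finset.card_univ, nsmul_eq_mul, mul_one]
  rw [eF, eK, eFK, eμ] at key
  have hN : (0 : ℤ) < Fintype.card (Finset γ) := by exact_mod_cast Fintype.card_pos
  -- `U.card * (k N) ≤ N * (k U.card - ∑_U g)`  ⟹  `N * ∑_U g ≤ 0`
  have hX : (Fintype.card (Finset γ) : ℤ) * ∑ z ∈ U, g z ≤ 0 := by nlinarith [key]
  exact nonpos_of_mul_nonpos_right hX hN

/-- The sum of a monotone odd function over the up-cylinder `{S ⊆ x}` is non-negative. -/
lemma sum_upcyl_nonneg {ι : Type*} [Fintype ι] [DecidableEq ι] (S : Finset ι)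
    {f : Finset ι → ℤ} (hf : Monotone f) (hfκ : ∀ x, f xᶜ = -f x) :
    0 ≤ ∑ x ∈ univ.filter (fun x : Finset ι => S ⊆ x), f x := by
  classical
  -- the involution `x ↦ S ∪ xᶜ` of the cylinder
  have hmem : ∀ x : Finset ι, S ⊆ x → S ⊆ S ∪ xᶜ := fun x _ => Finset.subset_union_left
  have hinv : ∀ x : Finset ι, S ⊆ x → S ∪ (S ∪ xᶜ)ᶜ = x := by
    intro x hx
    rw [Finset.compl_union, compl_compl]
    ext a; simp only [Finset.mem_union, Finset.mem_inter, Finset.mem_compl]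
    constructor
    · rintro (ha | ⟨_, ha⟩)
      · exact hx ha
      · exact ha
    · intro ha
      by_cases hs : a ∈ S
      · exact Or.inl hs
      · exact Or.inr ⟨hs, ha⟩
  have hpair : ∑ x ∈ univ.filter (fun x : Finset ι => S ⊆ x), f x =
      ∑ x ∈ univ.filter (fun x : Finset ι => S ⊆ x), f (S ∪ xᶜ) := by
    refine (Finset.sum_nbij' (fun x => S ∪ xᶜ) (fun x => S ∪ xᶜ) ?_ ?_ ?_ ?_ ?_).symm
    · intro x hx; simp only [Finset.mem_filter, Finset.mem_univ, true_and] at hx ⊢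
      exact hmem x hx
    · intro x hx; simp only [Finset.mem_filter, Finset.mem_univ, true_and] at hx ⊢
      exact hmem x hx
    · intro x hx; simp only [Finset.mem_filter, Finset.mem_univ, true_and] at hx
      exact hinv x hx
    · intro x hx; simp only [Finset.mem_filter, Finset.mem_univ, true_and] at hx
      exact hinv x hx
    · intro x _; rfl
  have h2 : 2 * ∑ x ∈ univ.filter (fun x : Finset ι => S ⊆ x), f x =
      ∑ x ∈ univ.filter (fun x : Finset ι => S ⊆ x), (f x + f (S ∪ xᶜ)) := by
    rw [Finset.sum_add_distrib, ← hpair]; ring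
  have hterm : ∀ x : Finset ι, 0 ≤ f x + f (S ∪ xᶜ) := fun x => by
    have := hf (Finset.subset_union_right (s₁ := S) (s₂ := xᶜ))
    have := hfκ x; linarith
  have : 0 ≤ ∑ x ∈ univ.filter (fun x : Finset ι => S ⊆ x), (f x + f (S ∪ xᶜ)) :=
    Finset.sum_nonneg fun x _ => hterm x
  linarith

/-- **CLASS C5, the assembly.** `S ⊆ ι` the blocks joined to `d`; `U` an up-set of the
pocket cube (legality of a `Y`-reached `d`), `D` complement-closed (the two pockets of a
doubly reached `d` meet only in `d`); `f` monotone odd, `g` antitone odd. -/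
theorem c5_sum_nonpos {ι γ : Type*} [Fintype ι] [DecidableEq ι] [Fintype γ] [DecidableEq γ]
    (S : Finset ι) {U D : Finset (Finset γ)}
    (hU : ∀ ⦃z z' : Finset γ⦄, z ∈ U → z ⊆ z' → z' ∈ U) (hD : ∀ z, z ∈ D → zᶜ ∈ D)
    {f : Finset ι → ℤ} (hf : Monotone f) (hfκ : ∀ x, f xᶜ = -f x)
    {g : Finset γ → ℤ} (hg : Antitone g) (hgκ : ∀ z, g zᶜ = -g z) :
    ∑ x : Finset ι, ∑ z : Finset γ,
      (if ((S ∩ x).Nonempty → z ∈ U) ∧ (¬ S ⊆ x → zᶜ ∈ U) ∧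
          ((S ∩ x).Nonempty ∧ ¬ S ⊆ x → z ∈ D) then (1 : ℤ) else 0) * (f x * g z) ≤ 0 := by
  classical
  -- the three values of the inner sum
  let ΨK : ℤ := ∑ z ∈ U, g z
  have hΨK : ΨK ≤ 0 := sum_upset_nonpos hU hg hgκ
  have hcompl : ∑ z ∈ univ.filter (fun z : Finset γ => zᶜ ∈ U), g z = -ΨK := by
    have : ∑ z ∈ univ.filter (fun z : Finset γ => zᶜ ∈ U), g z = ∑ z ∈ U, g zᶜ := by
      refine Finset.sum_nbij' compl compl ?_ ?_ ?_ ?_ ?_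
      · intro z hz; simpa using hz
      · intro z hz; simp only [Finset.mem_filter, Finset.mem_univ, true_and, compl_compl]; exact hz
      · intro z _; exact compl_compl z
      · intro z _; exact compl_compl z
      · intro z _; rw [compl_compl]
    rw [this, ← Finset.sum_neg_distrib]
    exact Finset.sum_congr rfl fun z _ => hgκ z
  have hsym : ∑ z ∈ univ.filter (fun z : Finset γ => z ∈ U ∧ zᶜ ∈ U ∧ z ∈ D), g z = 0 := by
    set T := univ.filter (fun z : Finset γ => z ∈ U ∧ zᶜ ∈ U ∧ z ∈ D) with hT
    have hTc : ∀ z ∈ T, zᶜ ∈ T := by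
      intro z hz
      simp only [hT, Finset.mem_filter, Finset.mem_univ, true_and, compl_compl] at hz ⊢
      exact ⟨hz.2.1, hz.1, hD z hz.2.2⟩
    have h1 : ∑ z ∈ T, g zᶜ = ∑ z ∈ T, g z :=
      Finset.sum_nbij' compl compl (fun z hz => hTc z hz) (fun z hz => hTc z hz)
        (fun z _ => compl_compl z) (fun z _ => compl_compl z) (fun z _ => rfl)
    have h2 : ∑ z ∈ T, g zᶜ = -∑ z ∈ T, g z := by
      rw [← Finset.sum_neg_distrib]; exact Finset.sum_congr rfl fun z _ => hgκ z
    linarith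
  -- the inner sum as a function of the status of `x`
  have hinner : ∀ x : Finset ι, (∑ z : Finset γ,
      (if ((S ∩ x).Nonempty → z ∈ U) ∧ (¬ S ⊆ x → zᶜ ∈ U) ∧
          ((S ∩ x).Nonempty ∧ ¬ S ⊆ x → z ∈ D) then (1 : ℤ) else 0) * (f x * g z)) =
      f x * (if S ⊆ x then (if (S ∩ x).Nonempty then ΨK else 0)
        else (if (S ∩ x).Nonempty then 0 else -ΨK)) := by
    intro x
    have conv : ∀ (P : Finset γ → Prop) [DecidablePred P],
        (∑ z : Finset γ, (if P z then (1 : ℤ) else 0) * (f x * g z)) =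
          f x * ∑ z ∈ univ.filter P, g z := by
      intro P _
      rw [Finset.mul_sum, Finset.sum_filter]
      refine Finset.sum_congr rfl fun z _ => ?_
      split_ifs <;> ring
    by_cases h1 : S ⊆ x <;> by_cases h2 : (S ∩ x).Nonempty
    · -- `d` in the `Y`-world only: legal ⟺ `z ∈ U`
      have : ∀ z : Finset γ, (((S ∩ x).Nonempty → z ∈ U) ∧ (¬ S ⊆ x → zᶜ ∈ U) ∧
          ((S ∩ x).Nonempty ∧ ¬ S ⊆ x → z ∈ D)) ↔ z ∈ U := fun z => by
        constructor
        · rintro ⟨hz, -, -⟩; exact hz h2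
        · intro hz; exact ⟨fun _ => hz, fun h => absurd h1 h, fun h => absurd h1 h.2⟩
      simp_rw [this]
      rw [conv (fun z => z ∈ U), if_pos h1, if_pos h2]
      simp only [ΨK, Finset.filter_mem_eq_inter, Finset.univ_inter]
    · -- `S = ∅` (both `S ⊆ x` and `S ∩ x = ∅`): everything legal, the odd sum vanishes
      have : ∀ z : Finset γ, (((S ∩ x).Nonempty → z ∈ U) ∧ (¬ S ⊆ x → zᶜ ∈ U) ∧
          ((S ∩ x).Nonempty ∧ ¬ S ⊆ x → z ∈ D)) ↔ True := fun z =>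
        iff_true_intro ⟨fun h => absurd h h2, fun h => absurd h1 h, fun h => absurd h1 h.2⟩
      simp_rw [this]
      rw [conv (fun _ => True), if_pos h1, if_neg h2]
      have hzero : ∑ z : Finset γ, g z = 0 := by
        have h1' : ∑ z : Finset γ, g zᶜ = ∑ z : Finset γ, g z :=
          Finset.sum_nbij' compl compl (fun z _ => Finset.mem_univ _)
            (fun z _ => Finset.mem_univ _) (fun z _ => compl_compl z) (fun z _ => compl_compl z)
            (fun z _ => rfl)
        have h2' : ∑ z : Finset γ, g zᶜ = -∑ z : Finset γ, g z := by
          rw [← Finset.sum_neg_distrib]; exact Finset.sum_congr rfl fun z _ => hgκ z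
        linarith
      rw [Finset.filter_true_of_mem (fun _ _ => trivial), hzero, mul_zero]
    · -- `d` doubly reached: legal ⟺ `z ∈ U ∧ zᶜ ∈ U ∧ z ∈ D`, a symmetric set
      have : ∀ z : Finset γ, (((S ∩ x).Nonempty → z ∈ U) ∧ (¬ S ⊆ x → zᶜ ∈ U) ∧
          ((S ∩ x).Nonempty ∧ ¬ S ⊆ x → z ∈ D)) ↔ (z ∈ U ∧ zᶜ ∈ U ∧ z ∈ D) := fun z => by
        constructor
        · rintro ⟨ha, hb, hc⟩; exact ⟨ha h2, hb h1, hc ⟨h2, h1⟩⟩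
        · rintro ⟨ha, hb, hc⟩; exact ⟨fun _ => ha, fun _ => hb, fun _ => hc⟩
      simp_rw [this]
      rw [conv (fun z => z ∈ U ∧ zᶜ ∈ U ∧ z ∈ D), if_neg h1, if_pos h2, hsym, mul_zero]
    · -- `d` in the `W`-world only: legal ⟺ `zᶜ ∈ U`
      have : ∀ z : Finset γ, (((S ∩ x).Nonempty → z ∈ U) ∧ (¬ S ⊆ x → zᶜ ∈ U) ∧
          ((S ∩ x).Nonempty ∧ ¬ S ⊆ x → z ∈ D)) ↔ zᶜ ∈ U := fun z => by
        constructor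
        · rintro ⟨-, hb, -⟩; exact hb h1
        · intro hz; exact ⟨fun h => absurd h h2, fun _ => hz, fun h => absurd h.1 h2⟩
      simp_rw [this]
      rw [conv (fun z => zᶜ ∈ U), if_neg h1, if_neg h2, hcompl]
  simp_rw [hinner]
  -- the outer sum: `ΨK * (∑_{S ⊆ x, S ≠ ∅} f − ∑_{S ∩ x = ∅, S ≠ ∅} f)`
  by_cases hS : S = ∅
  · -- everything is `0`
    subst hS
    simp
  · have hne : S.Nonempty := Finset.nonempty_iff_ne_empty.2 hS
    have hval : ∀ x : Finset ι, (if S ⊆ x then (if (S ∩ x).Nonempty then ΨK else 0)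
        else (if (S ∩ x).Nonempty then 0 else -ΨK)) =
        ΨK * ((if S ⊆ x then (1 : ℤ) else 0) - (if S ⊆ xᶜ then (1 : ℤ) else 0)) := by
      intro x
      by_cases h1 : S ⊆ x
      · have h2 : (S ∩ x).Nonempty := by
          obtain ⟨a, ha⟩ := hne
          exact ⟨a, Finset.mem_inter.2 ⟨ha, h1 ha⟩⟩
        have h3 : ¬ S ⊆ xᶜ := fun h => by
          obtain ⟨a, ha⟩ := hne
          exact (Finset.mem_compl.1 (h ha)) (h1 ha)
        rw [if_pos h1, if_pos h2, if_pos h1, if_neg h3]; ring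
      · rw [if_neg h1, if_neg h1]
        by_cases h2 : (S ∩ x).Nonempty
        · have h3 : ¬ S ⊆ xᶜ := fun h => by
            obtain ⟨a, ha⟩ := h2
            have := Finset.mem_inter.1 ha
            exact (Finset.mem_compl.1 (h this.1)) this.2
          rw [if_pos h2, if_neg h3]; ring
        · have h3 : S ⊆ xᶜ := fun a ha => Finset.mem_compl.2 fun hx =>
            h2 ⟨a, Finset.mem_inter.2 ⟨ha, hx⟩⟩
          rw [if_neg h2, if_pos h3]; ring
    simp_rw [hval]
    -- `∑ f x * (ΨK * (1_{S ⊆ x} − 1_{S ⊆ xᶜ})) = 2 ΨK ∑_{S ⊆ x} f`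
    have hA : ∑ x : Finset ι, f x * (ΨK * ((if S ⊆ x then (1 : ℤ) else 0) -
        (if S ⊆ xᶜ then (1 : ℤ) else 0))) =
        ΨK * (2 * ∑ x ∈ univ.filter (fun x : Finset ι => S ⊆ x), f x) := by
      have e1 : ∑ x : Finset ι, f x * (if S ⊆ x then (1 : ℤ) else 0) =
          ∑ x ∈ univ.filter (fun x : Finset ι => S ⊆ x), f x := by
        simp only [mul_ite, mul_one, mul_zero]
        rw [← Finset.sum_filter]
      have e2 : ∑ x : Finset ι, f x * (if S ⊆ xᶜ then (1 : ℤ) else 0) =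
          -∑ x ∈ univ.filter (fun x : Finset ι => S ⊆ x), f x := by
        have : ∑ x : Finset ι, f x * (if S ⊆ xᶜ then (1 : ℤ) else 0) =
            ∑ x : Finset ι, f xᶜ * (if S ⊆ x then (1 : ℤ) else 0) :=
          Finset.sum_nbij' compl compl (fun x _ => Finset.mem_univ _)
            (fun x _ => Finset.mem_univ _) (fun x _ => compl_compl x) (fun x _ => compl_compl x)
            (fun x _ => by rw [compl_compl])
        rw [this]
        simp only [mul_ite, mul_one, mul_zero]
        rw [← Finset.sum_filter, ← Finset.sum_neg_distrib]
        exact Finset.sum_congr rfl fun x _ => hfκ x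
      have : ∀ x : Finset ι, f x * (ΨK * ((if S ⊆ x then (1 : ℤ) else 0) -
          (if S ⊆ xᶜ then (1 : ℤ) else 0))) =
          ΨK * (f x * (if S ⊆ x then (1 : ℤ) else 0) - f x * (if S ⊆ xᶜ then (1 : ℤ) else 0)) :=
        fun x => by ring
      simp_rw [this]
      rw [← Finset.mul_sum, Finset.sum_sub_distrib, e1, e2]; ring
    rw [hA]
    have := sum_upcyl_nonneg S hf hfκ
    nlinarith

end M9Reduce

end Summit.Ventures.PercRepro2
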